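import Literature.NumberTheory.Automorphic.UnitaryThreeAnisotropicFixedPointCriterion      -- ★ B-p14 (ii-a): `fixedPoint_mem_unitaryInt_iff`
import Literature.NumberTheory.Automorphic.UnitaryThreeAnisotropicFixedPointRegimes        -- ★ B-p14 (ii-b): `fixedPoint_cond01_iff`, `fixedPoint_expr00_eq_det_mul`, `fixedPoint_cond00_iff_of_two_mul_le`
import Literature.NumberTheory.Automorphic.UnitaryThreeAnisotropicStabilizerCosetCount     -- ★ FILE 2e-β (this seat): `[S : H′_m] = (q+1)q^{4m}`
import Literature.NumberTheory.Automorphic.UnitOrbitalIntegralUnfoldingAnisotropic         -- ★ (F2′): `smul_mk_eq_iff_flickerDiag`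
import HarnessLib

/-!
# Prop. 16, regime `m ≤ [N∕2]`: every coset of `Stab(w₀) ⧸ H′_m` is `t`-fixed iff `A_t ≡ 1 (mod 𝔭^{2m+1})`, so the fixed-point count is `(q+1)q^{4m}` or `0`
# (Flicker 1998, Prop. 16 p. 96 — LAYER B′ step 2, FILE 3 (iii-a))

Topic `NumberTheory/Automorphic`; namespace `Literature.NumberTheory.Automorphic.UnitaryGroup`.  THEOREMS ONLY (no `def`, no instance, no notation, no named fact, no
`sorry`; count-neutral).  Cell `pub/hodgecm-mathlib`, F0∕P3a road «D-N7-inert», line «N7nsCount» ((F11-c) `stub_irredGValueNeg`); LAYER B′ design pen + cutting hand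
A-p13 (g30) (DESIGN v3 `F0/P3a/A-p13/g30/DESIGN-LayerBprime-v3.A-p13g30.md`).  HONEST LABEL: HC_CM is proved only modulo the printed citations until rung 0 closes;
this file settles the FIRST ROW of Prop. 16's table only (regime `2m ≤ N`); the rows `[N∕2] < m ≤ N` are FILE 3 (iii-b).

THE MATHEMATICS.  `t ∈ S = Stab(w₀)` with coordinates `(b_t, q_t, r_t, s_t)`, `A_t = 1 + 4ϖb_t`, of «exponent `N`»: `|q_t| = |r_t| = |ϖ|^N`, `|A_t − s_t| ≤ |ϖ|^{N+1}`.  For a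
coset `hH′_m` (`h ↔ (b,q,r,s)`): `t·hH′_m = hH′_m ⟺ (hd_m)⁻¹ t (hd_m) ∈ K₀` (★ (F2′)) `⟺ cond₁ ∧ cond₂` (★ B-p14 (ii-a)); `cond₁ ⟺ m ≤ N` (★ (ii-b)), automatic when
`2m ≤ N`; `cond₂`'s expression is `D_h·[(A_t − 1) − 4ϖ(A_t − s_t)N(q) − 4ϖ(…)]` (★ `fixedPoint_expr00_eq_det_mul`, `|D_h| = 1`) and for `2m ≤ N` the bracket condition is
`|A_t − 1| ≤ |ϖ^{2m+1}|` (★ `fixedPoint_cond00_iff_of_two_mul_le`) — INDEPENDENT OF `h`.  Hence (§1) **`t·hH′_m = hH′_m ⟺ |A_t − 1| ≤ |ϖ^{2m+1}|`** and (§2) **`#Fix_t(S ⧸ H′_m) =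
[ |A_t − 1| ≤ |ϖ^{2m+1}| ]·(q+1)q^{4m}`** (★ FILE 2e-β `natCard_stabilizer_quotient_conjInt_eq`) — Flicker p. 96: «when `0 ≤ m ≤ [N∕2]` … the number is `(q+1)q^{4m}` if
`A_t ∈ 1 + 𝔭^{2m+1}` and `0` otherwise».

## References
* [Flicker1998UnitaryFL] Y. Z. Flicker, *Elementary proof of the fundamental lemma for a unitary group*, Canad. J. Math. 50 (1998), Prop. 16 p. 96.
-/

set_option autoImplicit false

noncomputable section

open scoped MatrixGroups WithZero Valued
open Matrix

namespace Literature.NumberTheory.Automorphic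

namespace UnitaryGroup

open Literature.NumberTheory.Automorphic.HermitianLattice

variable {K : Type*} [Field K] [Valued K ℤᵐ⁰] {ϖ : K}
  (σ : K →+* K) {J : Matrix (Fin 3) (Fin 3) K} (hJ : J = (StdForm.antidiagonal 3).over K)

/-! ## §1 The per-coset criterion in the regime `2m ≤ N` -/

set_option synthInstance.maxHeartbeats 200000 in
-- the `↥S`-action on `↥S ⧸ H′_m` is slow to synthesise (as in ★ (F2′))
include hJ in
/-- **`t·hH′_m = hH′_m ⟺ |A_t − 1| ≤ |ϖ^{2m+1}|` when `2m ≤ N`** (`t ∈ Stab(w₀)` of exponent `N`: `|q_t| = |r_t| = |ϖ|^N`, `|A_t − s_t| ≤ |ϖ|^{N+1}`; any coset `hH′_m`).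
★ (F2′) `smul_mk_eq_iff_flickerDiag` + ★ (ii-a) `fixedPoint_mem_unitaryInt_iff` + ★ (ii-b). [cite: Flicker1998UnitaryFL, Prop. 16 p. 96] -/
theorem smul_mk_eq_iff_of_two_mul_le (hd : LocalConjDatum σ ϖ) (d : ℕ → ↥(unitaryGroupOfForm σ J)) (m : ℕ)
    (hdm : ((d m : GL (Fin 3) K) : Matrix (Fin 3) (Fin 3) K) = !![ϖ ^ m, 0, 0; 0, 1, 0; 0, 0, (ϖ ^ m)⁻¹])
    {t : ↥(unitaryGroupOfForm σ J)} (ht : t ∈ MulAction.stabilizer (↥(unitaryGroupOfForm σ J)) (![1, 0, -(2 * ϖ)] : Fin 3 → K)) {bt qt rt st : K}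
    (htc : ((t : GL (Fin 3) K) : Matrix (Fin 3) (Fin 3) K) = !![1 + 2 * ϖ * bt, qt, bt; 2 * ϖ * rt, st, rt; 4 * ϖ ^ 2 * bt, 2 * ϖ * qt, 1 + 2 * ϖ * bt])
    (N : ℕ) (hmN : 2 * m ≤ N) (hqt : Valued.v qt = WithZero.exp (-(N : ℤ))) (hrt : Valued.v rt = WithZero.exp (-(N : ℤ)))
    (hAst : Valued.v ((1 + 4 * ϖ * bt) - st) ≤ WithZero.exp (-((N : ℤ) + 1)))
    (h : ↥(MulAction.stabilizer (↥(unitaryGroupOfForm σ J)) (![1, 0, -(2 * ϖ)] : Fin 3 → K))) :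
    (⟨t, ht⟩ : ↥(MulAction.stabilizer (↥(unitaryGroupOfForm σ J)) (![1, 0, -(2 * ϖ)] : Fin 3 → K))) •
        (QuotientGroup.mk h : ↥(MulAction.stabilizer (↥(unitaryGroupOfForm σ J)) (![1, 0, -(2 * ϖ)] : Fin 3 → K)) ⧸
          ((unitaryInt σ J).map (MulAut.conj (d m)).toMonoidHom).subgroupOf
            (MulAction.stabilizer (↥(unitaryGroupOfForm σ J)) (![1, 0, -(2 * ϖ)] : Fin 3 → K))) = QuotientGroup.mk h ↔
      Valued.v ((1 + 4 * ϖ * bt) - 1) ≤ Valued.v (ϖ ^ (2 * m + 1)) := by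
  obtain ⟨b, q, r, s, hh⟩ := exists_coords_of_mem_stabilizer σ hJ hd h
  -- data of `t` and `h`
  obtain ⟨hst1, -, hAt, -⟩ := stabilizer_valuation_bounds σ hJ hd htc
  obtain ⟨hs, hq, hA, -⟩ := stabilizer_valuation_bounds σ hJ hd hh
  obtain ⟨-, hU2, -⟩ := stabilizer_unitarity_relations σ hJ hd hh
  have hs0 : s ≠ 0 := fun h0 => by rw [h0, map_zero] at hs; exact zero_ne_one hs
  have hσs : σ s ≠ 0 := fun h0 => hs0 (by have e := congrArg σ h0; rwa [hd.σσ, map_zero] at e)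
  have hst0 : st ≠ 0 := fun h0 => by rw [h0, map_zero] at hst1; exact zero_ne_one hst1
  have hσst : σ st ≠ 0 := fun h0 => hst0 (by have e := congrArg σ h0; rwa [hd.σσ, map_zero] at e)
  have hA0 : 1 + 4 * ϖ * b ≠ 0 := fun h0 => by rw [h0, map_zero] at hA; exact zero_ne_one hA
  -- `ρ = 4ϖr = −4ϖAσq∕σs`, `ρ_t` likewise, `Δ = A s − ρ q = A∕σs`
  have hρ : 4 * ϖ * r = -(4 * ϖ * (1 + 4 * ϖ * b) * σ q) / σ s := by rw [stabilizer_r_eq σ hJ hd hh]; field_simp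
  have hρt : 4 * ϖ * rt = -(4 * ϖ * (1 + 4 * ϖ * bt) * σ qt) / σ st := by rw [stabilizer_r_eq σ hJ hd htc]; field_simp
  have hΔ : (1 + 4 * ϖ * b) * s - 4 * ϖ * r * q = (1 + 4 * ϖ * b) / σ s := by
    have e := det_stabilizerModel_eq σ hJ hd hh
    rw [Matrix.det_fin_two_of] at e
    rw [← e]; ring
  have hvΔ : Valued.v ((1 + 4 * ϖ * b) * s - 4 * ϖ * r * q) = 1 := by rw [hΔ, map_div₀, hA, hd.vσ, hs, div_one]
  have key := fixedPoint_expr00_eq_det_mul σ ϖ (At := 1 + 4 * ϖ * bt) (qt := qt) (st := st) hA0 hσs hσst hΔ hρ hρt hU2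
  rw [smul_mk_eq_iff_flickerDiag σ d m ⟨t, ht⟩ h, Subgroup.coe_mk, fixedPoint_mem_unitaryInt_iff σ hJ hd m hdm htc hh,
    fixedPoint_cond01_iff σ hd hs hq N m hqt hrt hAst, and_iff_right (by omega : m ≤ N)]
  -- condition 2: factor `Δ` out and use the regime lemma
  have e2 : s * ((1 + 4 * ϖ * bt) * (1 + 4 * ϖ * b) + qt * (4 * ϖ * r)) - q * (4 * ϖ * rt * (1 + 4 * ϖ * b) + st * (4 * ϖ * r)) -
      ((1 + 4 * ϖ * b) * s - 4 * ϖ * q * r) =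
      ((1 + 4 * ϖ * b) * s - 4 * ϖ * r * q) *
        ((1 + 4 * ϖ * bt - 1) - 4 * ϖ * (1 + 4 * ϖ * bt - st) * (σ q * q) -
          4 * ϖ * (qt * σ q * s - (1 + 4 * ϖ * bt) / σ st * (σ qt * q * σ s))) := by
    linear_combination key
  rw [e2, map_mul, hvΔ, one_mul]
  exact fixedPoint_cond00_iff_of_two_mul_le σ hd hs hq hAt hst1 N m hmN hqt hAst

/-! ## §2 The count -/

set_option synthInstance.maxHeartbeats 200000 in
-- as above
include hJ in
/-- **PROP. 16, FIRST ROW: for `2m ≤ N`, `#Fix_t(S ⧸ H′_m) = (q+1)q^{4m}` if `A_t ≡ 1 (mod 𝔭^{2m+1})`, else `0`** — all cosets or none are fixed (§1), and there are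
`(q+1)q^{4m}` of them (★ FILE 2e-β).  The summand of ★ (F2′) `natCard_fixedPoints_unitaryInt_eq_finsum_flickerDiag`, verbatim. [cite: Flicker1998UnitaryFL, Prop. 16 p. 96] -/
theorem natCard_fixedPoints_quotient_of_two_mul_le (hd : LocalConjDatum σ ϖ) (hσO : ∀ y : 𝒪[K], (σ.comp 𝒪[K].subtype) y ∈ 𝒪[K])
    [IsDiscreteValuationRing 𝒪[K]] [Finite (IsLocalRing.ResidueField 𝒪[K])] [IsAdicComplete 𝓂[K] 𝒪[K]]
    {a₀ : 𝒪[K]} (ha₀ : IsUnit (((σ.comp 𝒪[K].subtype).codRestrict 𝒪[K] hσO) a₀ - a₀)) {q : ℕ} (hq : Nat.card (IsLocalRing.ResidueField 𝒪[K]) = q ^ 2)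
    (d : ℕ → ↥(unitaryGroupOfForm σ J)) (m : ℕ)
    (hdm : ((d m : GL (Fin 3) K) : Matrix (Fin 3) (Fin 3) K) = !![ϖ ^ m, 0, 0; 0, 1, 0; 0, 0, (ϖ ^ m)⁻¹])
    {t : ↥(unitaryGroupOfForm σ J)} (ht : t ∈ MulAction.stabilizer (↥(unitaryGroupOfForm σ J)) (![1, 0, -(2 * ϖ)] : Fin 3 → K)) {bt qt rt st : K}
    (htc : ((t : GL (Fin 3) K) : Matrix (Fin 3) (Fin 3) K) = !![1 + 2 * ϖ * bt, qt, bt; 2 * ϖ * rt, st, rt; 4 * ϖ ^ 2 * bt, 2 * ϖ * qt, 1 + 2 * ϖ * bt])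
    (N : ℕ) (hmN : 2 * m ≤ N) (hqt : Valued.v qt = WithZero.exp (-(N : ℤ))) (hrt : Valued.v rt = WithZero.exp (-(N : ℤ)))
    (hAst : Valued.v ((1 + 4 * ϖ * bt) - st) ≤ WithZero.exp (-((N : ℤ) + 1))) :
    Nat.card {z : ↥(MulAction.stabilizer (↥(unitaryGroupOfForm σ J)) (![1, 0, -(2 * ϖ)] : Fin 3 → K)) ⧸
          ((unitaryInt σ J).map (MulAut.conj (d m)).toMonoidHom).subgroupOf
            (MulAction.stabilizer (↥(unitaryGroupOfForm σ J)) (![1, 0, -(2 * ϖ)] : Fin 3 → K)) |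
        (⟨t, ht⟩ : ↥(MulAction.stabilizer (↥(unitaryGroupOfForm σ J)) (![1, 0, -(2 * ϖ)] : Fin 3 → K))) • z = z} =
      if Valued.v ((1 + 4 * ϖ * bt) - 1) ≤ Valued.v (ϖ ^ (2 * m + 1)) then (q + 1) * q ^ (4 * m) else 0 := by
  have hcrit : ∀ z : ↥(MulAction.stabilizer (↥(unitaryGroupOfForm σ J)) (![1, 0, -(2 * ϖ)] : Fin 3 → K)) ⧸
      ((unitaryInt σ J).map (MulAut.conj (d m)).toMonoidHom).subgroupOf (MulAction.stabilizer (↥(unitaryGroupOfForm σ J)) (![1, 0, -(2 * ϖ)] : Fin 3 → K)),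
      (⟨t, ht⟩ : ↥(MulAction.stabilizer (↥(unitaryGroupOfForm σ J)) (![1, 0, -(2 * ϖ)] : Fin 3 → K))) • z = z ↔
        Valued.v ((1 + 4 * ϖ * bt) - 1) ≤ Valued.v (ϖ ^ (2 * m + 1)) := by
    intro z
    induction z using QuotientGroup.induction_on with | H h => ?_
    exact smul_mk_eq_iff_of_two_mul_le σ hJ hd d m hdm ht htc N hmN hqt hrt hAst h
  split_ifs with hP
  · rw [← natCard_stabilizer_quotient_conjInt_eq σ hJ hd hσO ha₀ hq d m hdm]
    exact Nat.card_congr (Equiv.subtypeUnivEquiv fun z => (hcrit z).2 hP)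
  · haveI : IsEmpty {z : ↥(MulAction.stabilizer (↥(unitaryGroupOfForm σ J)) (![1, 0, -(2 * ϖ)] : Fin 3 → K)) ⧸
        ((unitaryInt σ J).map (MulAut.conj (d m)).toMonoidHom).subgroupOf (MulAction.stabilizer (↥(unitaryGroupOfForm σ J)) (![1, 0, -(2 * ϖ)] : Fin 3 → K)) |
        (⟨t, ht⟩ : ↥(MulAction.stabilizer (↥(unitaryGroupOfForm σ J)) (![1, 0, -(2 * ϖ)] : Fin 3 → K))) • z = z} :=
      ⟨fun z => hP ((hcrit z.1).1 z.2)⟩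
    exact Nat.card_of_isEmpty

end UnitaryGroup

end Literature.NumberTheory.Automorphic

end
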